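import Mathlib
import Summits.AtomisticToContinuum.Crystallization.Theorems.GappedShellCensusCleanLimitsHaveWindowsDefs
import Summits.AtomisticToContinuum.Crystallization.Theorems.PhononSlackCertificatesPeriodicGivenLayeredWindowBounds1

/-!
# Crux `GappedShellCensus.CleanLimitsHaveWindows` (stmt-AtomisticToContinuum-15932), line `Sketch`: stub R1 `stub_clusterTrial`

The ground-state-free CLUSTER TRIAL BOUND used to strip `groundStateEnergy` from the laminar kernel: for a `9/10`-separated set
`S ⊆ ℝ³` and a finite window `W ⊆ S`, `2 E_LJ(#W) ≤ Σ_{p ∈ W} e_p(S) + C Σ_{p ∈ W} (1 + dist(p, S ∖ W))⁻³`. This is the landed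
lower window bound (L) `LayeredHull.wb_lower` (take `W` itself as the trial configuration; the attraction across `∂W` is a
boundary-layer sum) at `δ = 9/10`, restated with the site-energy vocabulary `CleanHull.siteEnergy` of `…Defs.lean`.
-/

noncomputable section

namespace Summit.AtomisticToContinuum.Crystallization.Theorems.CleanHull

open scoped BigOperators
open Literature.MathematicalPhysics.StatisticalMechanics

/-- **Stub R1 (cluster trial bound; ground-state-free).** For a `9/10`-separated set `S` and a finite window `W ⊆ S`, twice the
ground-state energy of `#W` particles is at most the summed site energies of `W` in `S` plus a boundary-layer term — the landed
`LayeredHull.wb_lower` at `δ = 9/10`. [folklore] -/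
theorem stub_clusterTrial : ∃ C : ℝ, ∀ S : Set (EuclideanSpace ℝ (Fin 3)),
    (∀ p ∈ S, ∀ q ∈ S, p ≠ q → (9 / 10 : ℝ) ≤ dist p q) →
    ∀ W : Finset (EuclideanSpace ℝ (Fin 3)), (↑W : Set (EuclideanSpace ℝ (Fin 3))) ⊆ S →
      2 * groundStateEnergy lennardJones 3 W.card ≤
        ∑ p ∈ W, siteEnergy S p + C * ∑ p ∈ W, (1 + Metric.infDist p (S \ (↑W : Set (EuclideanSpace ℝ (Fin 3)))))⁻¹ ^ 3 := by
  obtain ⟨C, hC⟩ := LayeredHull.wb_lower (9 / 10) (by norm_num)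
  refine ⟨C, fun S hS W hW => ?_⟩
  have h := hC S hS W hW
  simp only [siteEnergy]
  linarith

end Summit.AtomisticToContinuum.Crystallization.Theorems.CleanHull

end
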